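import Literature.AnabelianGeometry.AbsoluteAnabelian.AbsTopIII.AutHolLogFrobenius
import HarnessLib

/-!
# [AbsTopIII] §4, Corollary 4.5 (iv): the first incompatibility, derived from Lemma 4.4

Mochizuki, *Topics in Absolute Anabelian Geometry III*, §4, Corollary 4.5 (iv) and its proof,
pp. 109–110 of the author's kurims manuscript (lit key `paper:url-5493eb38cbb7`).  Bib key
`MochizukiAbsTopIII2015`.  Companion of `AbsTopIII/AutHolLogFrobenius.lean` (block W2-B4 of the
abc-iut cell, node `AbsTopIII:Cor4.5(iv)`).

Cor. 4.5 (iv), first sentence: "The diagram of categories `𝒟_{≤2}` does not admit a structure of core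
on `𝒟_{≤1}` which [...] is compatible with [...] the observable `𝔖_log` of (iii)."  Its typed form is
`LogFrobeniusData.IncompatibleStmt` (`AbsTopIII/FrobeniusPictureMLF.lean`, first conjunct of
`Cor_4_5_iv`): no single
family of homotopies on `𝒟_{≤3}` (Def. 3.5 (ii)) contains the would-be core isomorphism for the pair
`([id_{⋎+1}], [id_⋎]∘[log])` together with the generating homotopies `ι_×` (pair `([λ^∼],[λ^×])`) and
`ι_log,⋎` (pair `([λ^×]∘[id_⋎]∘[log], [λ^∼]∘[id_{⋎+1}])`) of `𝔖_log`.  The printed proof (p. 110):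
such a family would contain `ζ₀` (core, an isomorphism), hence `ζ'₀ = λ^×(ζ₀)`, the type (1)
homotopy `ζ₁` and the type (4) homotopy `ζ₂`, and "`ζ'₁ = ζ₂ ∘ ζ₁ ∘ ζ'₀ : λ^× ∘ id_⋎ → λ^× ∘ id_⋎` —
which, in order for the desired compatibility to hold, must coincide with the 'identity homotopy'
[...]. On the other hand, by writing out explicitly the meaning of such an equality `ζ'₁ = id`, we
conclude that we obtain a contradiction to Lemma 4.4."

This file RUNS that argument inside the axioms of a family of homotopies (saturation of the
boundary set; `ζ_{([γ],[γ])} = id`; composition; whiskering — `HomotopyFamily` of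
`DiagramsOfCategories.lean`), for an ARBITRARY diagram of categories
(`false_of_core_compatible_of_obstruction`), and specialises it to the diagram `𝒟_{≤3}` of the
abstract input data: `incompatibleStmt_of_lemma44` — `IncompatibleStmt` holds for every input datum
of Aut-holomorphic type (`ι_× : λ^∼ → λ^×`) with an object in the first row, GIVEN the component-level
content of Lemma 4.4 (`Lemma44Property`: for an isomorphism `α`, the composite
"`k^× →α (k~)^× ↪ k~ ↠ k^×`" is not the identity).  For the data of Def. 4.1 that property is
Lemma 4.4 itself (`addMulDistinguishableArch`, `ArchimedeanLogFrobenius.lean`); here it is a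
hypothesis on the abstract data, so the theorem is a discharged DEDUCTION, not an instance.

Technical note.  The path functors `𝒟_[γ]` of `DiagramsOfCategories.lean` are defined by recursion on
paths and agree with the composites of the edge functors only propositionally
(`pathFunctor_nil`, `pathFunctor_cons`); the proof therefore transports components along these
identifications with `eqToHom`, merged by the small `eqToHom` lemmas below.
-/

namespace Literature.AnabelianGeometry.AbsoluteAnabelian.AbsTopIII

open _root_.CategoryTheory _root_.Quiver

universe u v' u' w' v₁ v₂ u₁ u₂

/-! ### Small `eqToHom` lemmas -/

section Incompatibility

/-- Components of a natural transformation at propositionally equal objects. [folklore] -/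
private theorem app_eq_of_obj_eq {C : Type u₁} [Category.{v₁} C] {C' : Type u₂} [Category.{v₂} C']
    {F G : C ⥤ C'} (θ : F ⟶ G) {X Y : C} (h : X = Y) :
    θ.app X = eqToHom (by rw [h]) ≫ θ.app Y ≫ eqToHom (by rw [h]) := by
  subst h
  simp

/-- Conjugating an identity by `eqToHom` gives an identity. [folklore] -/
private theorem eqToHom_conj_eq_id {C : Type u₁} [Category.{v₁} C] {X Y : C} (h : X = Y) {f : X ⟶ X}
    (hf : f = 𝟙 X) : eqToHom h.symm ≫ f ≫ eqToHom h = 𝟙 Y := by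
  subst hf
  simp

/-- Merging the `eqToHom`s of a singly nested conjugate. [folklore] -/
private theorem eqToHom_sandwich {C : Type u₁} [Category.{v₁} C] {A B₁ B₂ C₁ C₂ E : C} (p : A = B₁)
    (q : B₁ = B₂) (m : B₂ ⟶ C₁) (r : C₁ = C₂) (s : C₂ = E) :
    eqToHom p ≫ (eqToHom q ≫ m ≫ eqToHom r) ≫ eqToHom s =
      eqToHom (p.trans q) ≫ m ≫ eqToHom (r.trans s) := by
  cases p; cases q; cases r; cases s; simp

/-- Merging the `eqToHom`s of a doubly nested conjugate. [folklore] -/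
private theorem eqToHom_sandwich₂ {C : Type u₁} [Category.{v₁} C] {A B₁ B₂ B₃ C₁ C₂ C₃ E : C} (p : A = B₁)
    (q : B₁ = B₂) (q' : B₂ = B₃) (m : B₃ ⟶ C₁) (r : C₁ = C₂) (r' : C₂ = C₃) (s : C₃ = E) :
    eqToHom p ≫ (eqToHom q ≫ (eqToHom q' ≫ m ≫ eqToHom r) ≫ eqToHom r') ≫ eqToHom s =
      eqToHom (p.trans (q.trans q')) ≫ m ≫ eqToHom (r.trans (r'.trans s)) := by
  cases p; cases q; cases q'; cases r; cases r'; cases s; simp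

/-- Composing two `eqToHom`-conjugates whose middle `eqToHom`s cancel. [folklore] -/
private theorem eqToHom_sandwich_comp {C : Type u₁} [Category.{v₁} C] {A X Y Y' Z W : C} (a : A = X)
    (f : X ⟶ Y) (b : Y = Y') (b' : Y' = Y) (g : Y ⟶ Z) (c : Z = W) :
    (eqToHom a ≫ f ≫ eqToHom b) ≫ (eqToHom b' ≫ g ≫ eqToHom c) =
      eqToHom a ≫ (f ≫ g) ≫ eqToHom c := by
  cases a; cases b; cases c; simp

/-! ### The printed argument, for an arbitrary family of homotopies -/

/-- **The core of the proof of Cor. 4.5 (iv) (and of Cor. 3.6 (iv)), for an arbitrary family of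
homotopies `K` on an arbitrary diagram of categories.**  Five edges `log : v₁ → v₀`,
`id₁ : v₁ → □`, `id₀ : v₀ → □`, `λ^×, λ^∼ : □ → 𝒩`; natural transformations `ι_×` between the last two
edge functors and `ι_log` between the path functors of `[λ^×]∘[id₀]∘[log]` and `[λ^∼]∘[id₁]` (written
with the edge functors).  If `K` contains an ISOMORPHISM `ζ₀` for the pair `([id₁], [id₀]∘[log])`, the
pair `([λ^∼],[λ^×])` with components `ι_×` and the pair `([λ^×]∘[id₀]∘[log], [λ^∼]∘[id₁])` with
components `ι_log`, then at every object `x₀` the composite `λ^×(α) ≫ ι_log ≫ ι_×` — with `α` the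
component of `ζ₀` — is the identity: "`ζ'₁ = ζ₂ ∘ ζ₁ ∘ ζ'₀` … must coincide with the identity
homotopy" (the axioms of Def. 3.5 (ii): whiskering, composition, `ζ_{([γ],[γ])} = id`).  Hence a
component-level obstruction (Lemma 4.4) yields a contradiction.
[cite: MochizukiAbsTopIII2015, Corollary 4.5 (iv) p.110] -/
theorem false_of_core_compatible_of_obstruction {V : Type w'} [Quiver.{v'} V]
    {D : DiagramOfCategories.{v', u', w'} V} (K : D.HomotopyFamily) {v1 v0 sq ob : V}
    (eLog : v1 ⟶ v0) (eId1 : v1 ⟶ sq) (eId0 : v0 ⟶ sq) (eT eP : sq ⟶ ob)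
    (ιt : D.map eP ⟶ D.map eT)
    (ιl : (D.map eLog ⋙ D.map eId0) ⋙ D.map eT ⟶ D.map eId1 ⋙ D.map eP)
    (h₀ : K.E ((Path.nil : Path v1 v1).cons eId1) (((Path.nil : Path v1 v1).cons eLog).cons eId0))
    (hiso : IsIso (K.η h₀))
    (hP : K.E ((Path.nil : Path sq sq).cons eP) ((Path.nil : Path sq sq).cons eT))
    (hhP : ∀ (x : D.obj sq)
      (e₁ : (D.pathFunctor ((Path.nil : Path sq sq).cons eP)).obj x = (D.map eP).obj x)
      (e₂ : (D.pathFunctor ((Path.nil : Path sq sq).cons eT)).obj x = (D.map eT).obj x),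
      (K.η hP).app x = eqToHom e₁ ≫ ιt.app x ≫ eqToHom e₂.symm)
    (h₁ : K.E ((((Path.nil : Path v1 v1).cons eLog).cons eId0).cons eT)
      (((Path.nil : Path v1 v1).cons eId1).cons eP))
    (hh₁ : ∀ (x : D.obj v1)
      (e₁ : (D.pathFunctor ((((Path.nil : Path v1 v1).cons eLog).cons eId0).cons eT)).obj x =
        (D.map eT).obj ((D.map eId0).obj ((D.map eLog).obj x)))
      (e₂ : (D.pathFunctor (((Path.nil : Path v1 v1).cons eId1).cons eP)).obj x =
        (D.map eP).obj ((D.map eId1).obj x)),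
      (K.η h₁).app x = eqToHom e₁ ≫ ιl.app x ≫ eqToHom e₂.symm)
    (x₀ : D.obj v1)
    (obstruction : ∀ (a : (D.map eId1).obj x₀ ⟶ (D.map eId0).obj ((D.map eLog).obj x₀)), IsIso a →
      (D.map eT).map a ≫ ιl.app x₀ ≫ ιt.app ((D.map eId1).obj x₀) ≠
        𝟙 ((D.map eT).obj ((D.map eId1).obj x₀))) : False := by
  -- functor identifications along the explicit paths (equation lemmas of `pathFunctor`)
  have E0 : D.pathFunctor (Path.nil : Path v1 v1) = 𝟭 _ := DiagramOfCategories.pathFunctor_nil _ _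
  have E0' : D.pathFunctor (Path.nil : Path ob ob) = 𝟭 _ := DiagramOfCategories.pathFunctor_nil _ _
  have ET : D.pathFunctor ((Path.nil : Path sq sq).cons eT) = D.map eT := by
    rw [DiagramOfCategories.pathFunctor_cons, DiagramOfCategories.pathFunctor_nil, Functor.id_comp]
  have EP : D.pathFunctor ((Path.nil : Path sq sq).cons eP) = D.map eP := by
    rw [DiagramOfCategories.pathFunctor_cons, DiagramOfCategories.pathFunctor_nil, Functor.id_comp]
  have E1 : D.pathFunctor ((Path.nil : Path v1 v1).cons eId1) = D.map eId1 := by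
    rw [DiagramOfCategories.pathFunctor_cons, DiagramOfCategories.pathFunctor_nil, Functor.id_comp]
  have E2 : D.pathFunctor (((Path.nil : Path v1 v1).cons eLog).cons eId0) = D.map eLog ⋙ D.map eId0 := by
    rw [DiagramOfCategories.pathFunctor_cons, DiagramOfCategories.pathFunctor_cons,
      DiagramOfCategories.pathFunctor_nil, Functor.id_comp]
  have E3 : D.pathFunctor (((Path.nil : Path v1 v1).cons eId1).cons eT) = D.map eId1 ⋙ D.map eT := by
    rw [DiagramOfCategories.pathFunctor_cons, E1]
  have E4 : D.pathFunctor (((Path.nil : Path v1 v1).cons eId1).cons eP) = D.map eId1 ⋙ D.map eP := by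
    rw [DiagramOfCategories.pathFunctor_cons, E1]
  have E5 : D.pathFunctor ((((Path.nil : Path v1 v1).cons eLog).cons eId0).cons eT) =
      (D.map eLog ⋙ D.map eId0) ⋙ D.map eT := by
    rw [DiagramOfCategories.pathFunctor_cons, E2]
  -- ζ'₀ (`ζ₀` post-composed with `λ^×`), ζ₂ (`ι_×` pre-composed with `id₁`), and the chain
  have s1 : K.E ((((Path.nil : Path v1 v1).cons eId1)).cons eT)
      ((((Path.nil : Path v1 v1).cons eLog).cons eId0).cons eT) :=
    K.isSaturated.precomp (K.isSaturated.postcomp h₀ ((Path.nil : Path sq sq).cons eT)) Path.nil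
  have s3 : K.E (((Path.nil : Path v1 v1).cons eId1).cons eP)
      (((Path.nil : Path v1 v1).cons eId1).cons eT) :=
    K.isSaturated.precomp (K.isSaturated.postcomp hP Path.nil) ((Path.nil : Path v1 v1).cons eId1)
  -- ζ'₁ = ζ₂ ∘ ζ₁ ∘ ζ'₀ is the homotopy of a pair `([γ],[γ])`, hence the identity
  have key : (K.η s1 ≫ K.η h₁) ≫ K.η s3 = 𝟙 _ := by
    rw [← K.η_trans s1 h₁, ← K.η_trans]
    exact K.η_refl _
  -- the whiskering axiom of Def. 3.5 (ii) (b), for ζ'₀ and ζ₂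
  have W1 : K.η s1 = eqToHom (by rw [E3, E0, E1, ET, Functor.id_comp]) ≫
      Functor.whiskerLeft (D.pathFunctor (Path.nil : Path v1 v1))
        (Functor.whiskerRight (K.η h₀) (D.pathFunctor ((Path.nil : Path sq sq).cons eT))) ≫
      eqToHom (by rw [E5, E0, E2, ET, Functor.id_comp]) :=
    K.η_whisker h₀ Path.nil ((Path.nil : Path sq sq).cons eT)
  have W3 : K.η s3 = eqToHom (by rw [E4, E1, EP, E0', Functor.comp_id]) ≫
      Functor.whiskerLeft (D.pathFunctor ((Path.nil : Path v1 v1).cons eId1))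
        (Functor.whiskerRight (K.η hP) (D.pathFunctor (Path.nil : Path ob ob))) ≫
      eqToHom (by rw [E3, E1, ET, E0', Functor.comp_id]) :=
    K.η_whisker hP ((Path.nil : Path v1 v1).cons eId1) Path.nil
  -- components at `x₀` ("writing out explicitly the meaning of `ζ'₁ = id`"); the object
  -- identifications along the explicit paths are genuine transports (`pathFunctor` is recursive)
  have hx0 : (D.pathFunctor (Path.nil : Path v1 v1)).obj x₀ = x₀ := Functor.congr_obj E0 x₀
  have hx1 : (D.pathFunctor ((Path.nil : Path v1 v1).cons eId1)).obj x₀ = (D.map eId1).obj x₀ :=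
    Functor.congr_obj E1 x₀
  have o2 : (D.pathFunctor (((Path.nil : Path v1 v1).cons eLog).cons eId0)).obj x₀ =
      (D.map eId0).obj ((D.map eLog).obj x₀) := Functor.congr_obj E2 x₀
  have o3 : (D.pathFunctor (((Path.nil : Path v1 v1).cons eId1).cons eT)).obj x₀ =
      (D.map eT).obj ((D.map eId1).obj x₀) := Functor.congr_obj E3 x₀
  have M₁ : (D.pathFunctor (((Path.nil : Path v1 v1).cons eId1).cons eT)).obj x₀ =
      (D.map eT).obj ((D.pathFunctor ((Path.nil : Path v1 v1).cons eId1)).obj x₀) := by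
    rw [E3, E1]; rfl
  have M₂ : (D.map eT).obj ((D.pathFunctor (((Path.nil : Path v1 v1).cons eLog).cons eId0)).obj x₀) =
      (D.pathFunctor ((((Path.nil : Path v1 v1).cons eLog).cons eId0).cons eT)).obj x₀ := by
    rw [E5, E2]; rfl
  have N₁ : (D.pathFunctor ((((Path.nil : Path v1 v1).cons eLog).cons eId0).cons eT)).obj x₀ =
      (D.map eT).obj ((D.map eId0).obj ((D.map eLog).obj x₀)) := Functor.congr_obj E5 x₀
  have N₂ : (D.map eP).obj ((D.map eId1).obj x₀) =
      (D.pathFunctor (((Path.nil : Path v1 v1).cons eId1).cons eP)).obj x₀ := (Functor.congr_obj E4 x₀).symm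
  have R₂ : (D.map eT).obj ((D.map eId1).obj x₀) =
      (D.pathFunctor (((Path.nil : Path v1 v1).cons eId1).cons eT)).obj x₀ := o3.symm
  have W1x := NatTrans.congr_app W1 x₀
  simp only [NatTrans.comp_app, eqToHom_app, Functor.whiskerLeft_app, Functor.whiskerRight_app,
    Functor.congr_hom ET, app_eq_of_obj_eq (K.η h₀) hx0, Functor.map_comp, eqToHom_map,
    Category.assoc, eqToHom_trans, eqToHom_trans_assoc] at W1x
  have W1c : (K.η s1).app x₀ = eqToHom M₁ ≫ (D.map eT).map ((K.η h₀).app x₀) ≫ eqToHom M₂ :=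
    W1x.trans (eqToHom_sandwich _ _ _ _ _)
  have W2c : (K.η h₁).app x₀ = eqToHom N₁ ≫
      (ιl.app x₀ : (D.map eT).obj ((D.map eId0).obj ((D.map eLog).obj x₀)) ⟶
        (D.map eP).obj ((D.map eId1).obj x₀)) ≫ eqToHom N₂ :=
    hh₁ x₀ N₁ N₂.symm
  have W3x := NatTrans.congr_app W3 x₀
  simp only [NatTrans.comp_app, eqToHom_app, Functor.whiskerLeft_app, Functor.whiskerRight_app,
    Functor.congr_hom E0', Functor.id_map, app_eq_of_obj_eq (K.η hP) hx1,
    hhP ((D.map eId1).obj x₀) (Functor.congr_obj EP _) (Functor.congr_obj ET _),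
    Category.assoc, eqToHom_trans, eqToHom_trans_assoc] at W3x
  have W3c : (K.η s3).app x₀ = eqToHom N₂.symm ≫ ιt.app ((D.map eId1).obj x₀) ≫ eqToHom R₂ :=
    W3x.trans (eqToHom_sandwich₂ _ _ _ _ _ _ _)
  have keyx := NatTrans.congr_app key x₀
  simp only [NatTrans.comp_app, NatTrans.id_app, Category.assoc] at keyx
  rw [W1c, W2c, W3c] at keyx
  -- `ζ₁` followed by `ζ₂`: the middle transports cancel
  have k3 : (eqToHom M₁ ≫ (D.map eT).map ((K.η h₀).app x₀) ≫ eqToHom M₂) ≫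
      (eqToHom N₁ ≫ ((ιl.app x₀ : (D.map eT).obj ((D.map eId0).obj ((D.map eLog).obj x₀)) ⟶
        (D.map eP).obj ((D.map eId1).obj x₀)) ≫ ιt.app ((D.map eId1).obj x₀)) ≫ eqToHom R₂) =
      𝟙 _ :=
    (congrArg (fun t => (eqToHom M₁ ≫ (D.map eT).map ((K.η h₀).app x₀) ≫ eqToHom M₂) ≫ t)
      (eqToHom_sandwich_comp N₁
        (ιl.app x₀ : (D.map eT).obj ((D.map eId0).obj ((D.map eLog).obj x₀)) ⟶
          (D.map eP).obj ((D.map eId1).obj x₀))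
        N₂ N₂.symm (ιt.app ((D.map eId1).obj x₀)) R₂)).symm.trans keyx
  have keyx' := eqToHom_conj_eq_id o3 k3
  simp only [Category.assoc, eqToHom_trans, eqToHom_trans_assoc, eqToHom_refl, Category.comp_id]
    at keyx'
  -- the isomorphism `α` and the obstruction
  haveI := hiso
  refine obstruction (eqToHom hx1.symm ≫ (K.η h₀).app x₀ ≫ eqToHom o2) inferInstance ?_
  simp only [Functor.map_comp, eqToHom_map, Category.assoc]
  exact keyx'

/-- Normalising lemma for the `§3` variant (left-hand side). [folklore] -/
private theorem eqToHom_sandwich_left {C : Type u₁} [Category.{v₁} C] {A S B C₁ C₂ T Y Y' : C}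
    (a : A = S) (p : S = B) (m : B ⟶ C₁) (q : C₁ = C₂) (r : C₂ = T) (f : T ⟶ Y) (b : Y = Y')
    (b' : Y' = Y) :
    eqToHom a ≫ ((eqToHom p ≫ m ≫ eqToHom q) ≫ (eqToHom r ≫ f ≫ eqToHom b)) ≫ eqToHom b' =
      eqToHom (a.trans p) ≫ m ≫ eqToHom (q.trans r) ≫ f := by
  cases a; cases p; cases q; cases r; cases b; simp

/-- Normalising lemma for the `§3` variant (right-hand side). [folklore] -/
private theorem eqToHom_sandwich_right {C : Type u₁} [Category.{v₁} C] {A S A' Y Y' : C}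
    (a : A = S) (r : S = A') (g : A' ⟶ Y) (b : Y = Y') (b' : Y' = Y) :
    eqToHom a ≫ (eqToHom r ≫ g ≫ eqToHom b) ≫ eqToHom b' = eqToHom (a.trans r) ≫ g := by
  cases a; cases r; cases b; simp

/-- **The same argument in the `§3` direction** (`ι_× : λ^× → λ^{×pf}`, proof of Cor. 3.6 (iv),
p. 81): if `K` contains an isomorphism `ζ₀` for `([id₁], [id₀]∘[log])`, the pair `([λ^×],[λ^{×pf}])`
with components `ι_×` and the type-(1) pair with components `ι_log`, then `ζ'₁ = ζ₁ ∘ ζ'₀` and `ζ₂`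
are homotopies for the SAME pair `([λ^×]∘[id₁], [λ^{×pf}]∘[id₁])`, hence equal ("must coincide with
the homotopy `ζ₂`"): at `x₀`, `λ^×(α) ≫ ι_log = ι_×`.  A component-level obstruction (Lemma 3.4)
yields a contradiction.  (For the seats discharging Cor. 3.6 (iv); not used by Cor. 4.5.)
[cite: MochizukiAbsTopIII2015, Corollary 3.6 (iv) p.81] -/
theorem false_of_core_compatible_of_obstruction_left {V : Type w'} [Quiver.{v'} V]
    {D : DiagramOfCategories.{v', u', w'} V} (K : D.HomotopyFamily) {v1 v0 sq ob : V}
    (eLog : v1 ⟶ v0) (eId1 : v1 ⟶ sq) (eId0 : v0 ⟶ sq) (eT eP : sq ⟶ ob)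
    (ιt : D.map eT ⟶ D.map eP)
    (ιl : (D.map eLog ⋙ D.map eId0) ⋙ D.map eT ⟶ D.map eId1 ⋙ D.map eP)
    (h₀ : K.E ((Path.nil : Path v1 v1).cons eId1) (((Path.nil : Path v1 v1).cons eLog).cons eId0))
    (hiso : IsIso (K.η h₀))
    (hT : K.E ((Path.nil : Path sq sq).cons eT) ((Path.nil : Path sq sq).cons eP))
    (hhT : ∀ (x : D.obj sq)
      (e₁ : (D.pathFunctor ((Path.nil : Path sq sq).cons eT)).obj x = (D.map eT).obj x)
      (e₂ : (D.pathFunctor ((Path.nil : Path sq sq).cons eP)).obj x = (D.map eP).obj x),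
      (K.η hT).app x = eqToHom e₁ ≫ ιt.app x ≫ eqToHom e₂.symm)
    (h₁ : K.E ((((Path.nil : Path v1 v1).cons eLog).cons eId0).cons eT)
      (((Path.nil : Path v1 v1).cons eId1).cons eP))
    (hh₁ : ∀ (x : D.obj v1)
      (e₁ : (D.pathFunctor ((((Path.nil : Path v1 v1).cons eLog).cons eId0).cons eT)).obj x =
        (D.map eT).obj ((D.map eId0).obj ((D.map eLog).obj x)))
      (e₂ : (D.pathFunctor (((Path.nil : Path v1 v1).cons eId1).cons eP)).obj x =
        (D.map eP).obj ((D.map eId1).obj x)),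
      (K.η h₁).app x = eqToHom e₁ ≫ ιl.app x ≫ eqToHom e₂.symm)
    (x₀ : D.obj v1)
    (obstruction : ∀ (a : (D.map eId1).obj x₀ ⟶ (D.map eId0).obj ((D.map eLog).obj x₀)), IsIso a →
      (D.map eT).map a ≫ ιl.app x₀ ≠ ιt.app ((D.map eId1).obj x₀)) : False := by
  have E0 : D.pathFunctor (Path.nil : Path v1 v1) = 𝟭 _ := DiagramOfCategories.pathFunctor_nil _ _
  have E0' : D.pathFunctor (Path.nil : Path ob ob) = 𝟭 _ := DiagramOfCategories.pathFunctor_nil _ _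
  have ET : D.pathFunctor ((Path.nil : Path sq sq).cons eT) = D.map eT := by
    rw [DiagramOfCategories.pathFunctor_cons, DiagramOfCategories.pathFunctor_nil, Functor.id_comp]
  have EP : D.pathFunctor ((Path.nil : Path sq sq).cons eP) = D.map eP := by
    rw [DiagramOfCategories.pathFunctor_cons, DiagramOfCategories.pathFunctor_nil, Functor.id_comp]
  have E1 : D.pathFunctor ((Path.nil : Path v1 v1).cons eId1) = D.map eId1 := by
    rw [DiagramOfCategories.pathFunctor_cons, DiagramOfCategories.pathFunctor_nil, Functor.id_comp]
  have E2 : D.pathFunctor (((Path.nil : Path v1 v1).cons eLog).cons eId0) = D.map eLog ⋙ D.map eId0 := by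
    rw [DiagramOfCategories.pathFunctor_cons, DiagramOfCategories.pathFunctor_cons,
      DiagramOfCategories.pathFunctor_nil, Functor.id_comp]
  have E3 : D.pathFunctor (((Path.nil : Path v1 v1).cons eId1).cons eT) = D.map eId1 ⋙ D.map eT := by
    rw [DiagramOfCategories.pathFunctor_cons, E1]
  have E4 : D.pathFunctor (((Path.nil : Path v1 v1).cons eId1).cons eP) = D.map eId1 ⋙ D.map eP := by
    rw [DiagramOfCategories.pathFunctor_cons, E1]
  have E5 : D.pathFunctor ((((Path.nil : Path v1 v1).cons eLog).cons eId0).cons eT) =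
      (D.map eLog ⋙ D.map eId0) ⋙ D.map eT := by
    rw [DiagramOfCategories.pathFunctor_cons, E2]
  have s1 : K.E ((((Path.nil : Path v1 v1).cons eId1)).cons eT)
      ((((Path.nil : Path v1 v1).cons eLog).cons eId0).cons eT) :=
    K.isSaturated.precomp (K.isSaturated.postcomp h₀ ((Path.nil : Path sq sq).cons eT)) Path.nil
  have s3 : K.E (((Path.nil : Path v1 v1).cons eId1).cons eT)
      (((Path.nil : Path v1 v1).cons eId1).cons eP) :=
    K.isSaturated.precomp (K.isSaturated.postcomp hT Path.nil) ((Path.nil : Path v1 v1).cons eId1)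
  -- `ζ₁ ∘ ζ'₀` and `ζ₂` are homotopies of the same pair, hence equal
  have kapp : (K.η s1).app x₀ ≫ (K.η h₁).app x₀ = (K.η s3).app x₀ := by
    rw [← NatTrans.comp_app, ← K.η_trans s1 h₁]
  have W1 : K.η s1 = eqToHom (by rw [E3, E0, E1, ET, Functor.id_comp]) ≫
      Functor.whiskerLeft (D.pathFunctor (Path.nil : Path v1 v1))
        (Functor.whiskerRight (K.η h₀) (D.pathFunctor ((Path.nil : Path sq sq).cons eT))) ≫
      eqToHom (by rw [E5, E0, E2, ET, Functor.id_comp]) :=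
    K.η_whisker h₀ Path.nil ((Path.nil : Path sq sq).cons eT)
  have W3 : K.η s3 = eqToHom (by rw [E3, E1, ET, E0', Functor.comp_id]) ≫
      Functor.whiskerLeft (D.pathFunctor ((Path.nil : Path v1 v1).cons eId1))
        (Functor.whiskerRight (K.η hT) (D.pathFunctor (Path.nil : Path ob ob))) ≫
      eqToHom (by rw [E4, E1, EP, E0', Functor.comp_id]) :=
    K.η_whisker hT ((Path.nil : Path v1 v1).cons eId1) Path.nil
  have hx0 : (D.pathFunctor (Path.nil : Path v1 v1)).obj x₀ = x₀ := Functor.congr_obj E0 x₀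
  have hx1 : (D.pathFunctor ((Path.nil : Path v1 v1).cons eId1)).obj x₀ = (D.map eId1).obj x₀ :=
    Functor.congr_obj E1 x₀
  have o2 : (D.pathFunctor (((Path.nil : Path v1 v1).cons eLog).cons eId0)).obj x₀ =
      (D.map eId0).obj ((D.map eLog).obj x₀) := Functor.congr_obj E2 x₀
  have o3 : (D.pathFunctor (((Path.nil : Path v1 v1).cons eId1).cons eT)).obj x₀ =
      (D.map eT).obj ((D.map eId1).obj x₀) := Functor.congr_obj E3 x₀
  have M₁ : (D.pathFunctor (((Path.nil : Path v1 v1).cons eId1).cons eT)).obj x₀ =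
      (D.map eT).obj ((D.pathFunctor ((Path.nil : Path v1 v1).cons eId1)).obj x₀) := by
    rw [E3, E1]; rfl
  have M₂ : (D.map eT).obj ((D.pathFunctor (((Path.nil : Path v1 v1).cons eLog).cons eId0)).obj x₀) =
      (D.pathFunctor ((((Path.nil : Path v1 v1).cons eLog).cons eId0).cons eT)).obj x₀ := by
    rw [E5, E2]; rfl
  have N₁ : (D.pathFunctor ((((Path.nil : Path v1 v1).cons eLog).cons eId0).cons eT)).obj x₀ =
      (D.map eT).obj ((D.map eId0).obj ((D.map eLog).obj x₀)) := Functor.congr_obj E5 x₀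
  have N₂ : (D.map eP).obj ((D.map eId1).obj x₀) =
      (D.pathFunctor (((Path.nil : Path v1 v1).cons eId1).cons eP)).obj x₀ := (Functor.congr_obj E4 x₀).symm
  have W1x := NatTrans.congr_app W1 x₀
  simp only [NatTrans.comp_app, eqToHom_app, Functor.whiskerLeft_app, Functor.whiskerRight_app,
    Functor.congr_hom ET, app_eq_of_obj_eq (K.η h₀) hx0, Functor.map_comp, eqToHom_map,
    Category.assoc, eqToHom_trans, eqToHom_trans_assoc] at W1x
  have W1c : (K.η s1).app x₀ = eqToHom M₁ ≫ (D.map eT).map ((K.η h₀).app x₀) ≫ eqToHom M₂ :=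
    W1x.trans (eqToHom_sandwich _ _ _ _ _)
  have W2c : (K.η h₁).app x₀ = eqToHom N₁ ≫
      (ιl.app x₀ : (D.map eT).obj ((D.map eId0).obj ((D.map eLog).obj x₀)) ⟶
        (D.map eP).obj ((D.map eId1).obj x₀)) ≫ eqToHom N₂ :=
    hh₁ x₀ N₁ N₂.symm
  have W3x := NatTrans.congr_app W3 x₀
  simp only [NatTrans.comp_app, eqToHom_app, Functor.whiskerLeft_app, Functor.whiskerRight_app,
    Functor.congr_hom E0', Functor.id_map, app_eq_of_obj_eq (K.η hT) hx1,
    hhT ((D.map eId1).obj x₀) (Functor.congr_obj ET _) (Functor.congr_obj EP _),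
    Category.assoc, eqToHom_trans, eqToHom_trans_assoc] at W3x
  have W3c : (K.η s3).app x₀ = eqToHom o3 ≫ ιt.app ((D.map eId1).obj x₀) ≫ eqToHom N₂ :=
    W3x.trans (eqToHom_sandwich₂ _ _ _ _ _ _ _)
  rw [W1c, W2c, W3c] at kapp
  have k5 := ((eqToHom_sandwich_left o3.symm M₁ _ M₂ N₁ _ N₂ N₂.symm).symm.trans
    ((congrArg (fun t => eqToHom o3.symm ≫ t ≫ eqToHom N₂.symm) kapp).trans
      (eqToHom_sandwich_right o3.symm o3 _ N₂ N₂.symm)))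
  simp only [eqToHom_refl, Category.id_comp] at k5
  haveI := hiso
  refine obstruction (eqToHom hx1.symm ≫ (K.η h₀).app x₀ ≫ eqToHom o2) inferInstance ?_
  simp only [Functor.map_comp, eqToHom_map, Category.assoc]
  exact k5

variable {Δ : LogFrobeniusData.{u}}

/-- **The component-level content of Lemma 4.4** for abstract archimedean input data ("writing out
explicitly the meaning of such an equality `ζ'₁ = id`", proof of Cor. 4.5 (iv) p. 110): for every
object `x` of the first row and every ISOMORPHISM `a : id_{⋎+1}(x) ⥲ id_⋎(log x)` of `𝒳` — inducing
"`α : k^× ⥲ (k~)^×`" on arithmetic data — the composite `λ^×(a) ≫ ι_log,⋎(x) ≫ ι_×`, i.e.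
"`k^× →α (k~)^× ↪ k~ ↠ k^×`", is NOT the identity (Lemma 4.4: it is not even bijective).  A property
of the data `Δ` (with `ι_× = ι`); for the data of Def. 4.1 it is the content of Lemma 4.4
(`addMulDistinguishableArch` in `ArchimedeanLogFrobenius.lean`).
[cite: MochizukiAbsTopIII2015, Lemma 4.4 p.107] -/
def Lemma44Property (ι : Δ.lamPf ⟶ Δ.lamTimes) : Prop :=
  ∀ (x : Δ.X₁) (a : Δ.toNexus.obj x ⟶ Δ.toNexus.obj (Δ.log.obj x)), IsIso a →
    Δ.lamTimes.map a ≫ ιlogApp x ≫ ι.app (Δ.toNexus.obj x) ≠ 𝟙 (Δ.lamTimes.obj (Δ.toNexus.obj x))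

/-- **Cor. 4.5 (iv), first incompatibility, from Lemma 4.4.**  For input data of Aut-holomorphic
type (`ι_× = ι : λ^∼ → λ^×`) whose first row has an object `x₀` and which satisfies the Lemma-4.4
property, "`𝒟_{≤2}` does not admit a structure of core on `𝒟_{≤1}` … compatible with … the observable
`𝔖_log`", in the typed form `LogFrobeniusData.IncompatibleStmt`.  The proof is the printed one
(`false_of_core_compatible_of_obstruction`): a common family of homotopies would contain the core
homotopy `ζ₀` for `([id_{⋎+1}], [id_⋎]∘[log])` (an isomorphism), hence — whiskering with `λ^×`,
composing with the type (1) homotopy `ι_log,⋎` and with the type (4) homotopy `ι_×` — a homotopy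
`ζ'₁ = ζ₂ ∘ ζ₁ ∘ ζ'₀ : λ^× ∘ id_{⋎+1} → λ^× ∘ id_{⋎+1}`, "which … must coincide with the 'identity
homotopy'"; "writing out explicitly the meaning of such an equality `ζ'₁ = id`" at `x₀` contradicts
the Lemma-4.4 property.
[cite: MochizukiAbsTopIII2015, Corollary 4.5 (iv) p.110] -/
theorem incompatibleStmt_of_lemma44 (ι : Δ.lamPf ⟶ Δ.lamTimes) (hι : Δ.ιtimes = Sum.inr ι)
    (x₀ : Δ.X₁) (h44 : Lemma44Property ι) : Δ.IncompatibleStmt := by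
  rintro ⟨K, hcore, htimes, hlog⟩
  obtain ⟨h₀, hiso⟩ := hcore 0
  rw [hι] at htimes
  obtain ⟨hP, hhP⟩ := htimes
  obtain ⟨h₁, hh₁⟩ := hlog 0
  exact false_of_core_compatible_of_obstruction K
    (v1 := LogFrobeniusData.lvRow1.{u} (0 + 1)) (v0 := LogFrobeniusData.lvRow1.{u} 0)
    (sq := LogFrobeniusData.lvNexus.{u}) (ob := LogFrobeniusData.lvObs.{u})
    (LFVertex.logEdge 0) (LFVertex.idEdge (0 + 1)) (LFVertex.idEdge 0)
    LogFrobeniusData.eLamTimes LogFrobeniusData.eLamPf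
    ι Δ.ιlog h₀ hiso hP hhP h₁ hh₁ x₀ (fun a ha => h44 x₀ a ha)

end Incompatibility

end Literature.AnabelianGeometry.AbsoluteAnabelian.AbsTopIII
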